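import Literature.Computability.AlgebraicComplexity.TensorOrbitClosedOfNoFixedTorus
import Literature.Computability.AlgebraicComplexity.MatMulPolystableProofs
import Literature.Computability.AlgebraicComplexity.BI17FundamentalInvariantTensors
import HarnessLib

/-!
# An `SL × SL × SL`-orbit of 3-tensors is closed if no point of its closure is fixed by a real torus

The TRIPLE-ACTION twin of `TensorOrbitClosedOfNoFixedTorus.lean` (the compactness half of Mumford's
stability argument, GIT Ch. 2 §1 / Prop. 4.2, in Kempf–Ness `KAK` form), for the factorwise action
`tripleAct A B C t` (= `actTensor`, `BI17FundamentalInvariantTensors.lean`) of three square matrices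
on `t : τ → τ → τ → ℂ` — the setting of Bürgisser–Ikenmeyer 2017 §4.2 ("we call a tensor
`w ∈ ⊗³ℂ^m` polystable iff the `SL_m^3`-orbit of `w` is closed", `IsPolystableTensor`) and of the
tensor version of their Prop. 2.10, Prop. 4.10 ("almost all `w ∈ ⊗³ℂ^m` are polystable").

`isClosed_tripleOrbit_of_closure_noFixedTorus`: if no point `t'` of the classical closure of
`{(A,B,C)·t | det A = det B = det C = 1}` is fixed by a non-trivial real diagonal one-parameter
subgroup `s ↦ (diag(exp(s e₀)), diag(exp(s e₁)), diag(exp(s e₂)))` (`∑ e_k = 0` for each `k`,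
`e ≠ 0`), then the orbit is closed; `isPolystableTensor_of_closure_noFixedTorus` is the same in the
`Set.range`/`actTensor` spelling of `IsPolystableTensor`.

## Proof

The proof of the one-matrix file, run on the block embedding `emb3 t` of `t` into the 3-tensors over
`τ × Fin 3` (`MatMulPolystableProofs.lean`: block-diagonal matrices act through `tripleAct`,
`tensorAct_blockDiagonal_emb3`). Write the three factors of a sequence `(A_m, B_m, C_m)·t → y` as
`V diag(e^θ) W` (`exists_kak_of_det_eq_one`); the block-diagonal matrix is then
`V̂ diag(e^Θ) Ŵ` on `ℂ^{τ × Fin 3}` with `Θ(a,k) = θ_k(a)`, and `‖(A,B,C)·t‖² =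
∑_j e^{2⟨Θ, ct j⟩} ‖(Ŵ • emb3 t)_j‖²` (`tnormSq_tensorAct_kak`). Bounded `Θ`: compactness of
`U(τ)³` gives a limit triple in `SL³` (Case A). Unbounded: `Θ/‖Θ‖ → E ≠ 0` with each block of `E`
summing to `0`, the coordinates of positive `E`-weight of `Ŵ_∞ • emb3 t` vanish, and after rescaling
the three limit unitaries into `SL` the tensors `diag(exp(s E)) Ŵ' • emb3 t` — which ARE of the form
`emb3 ((A,B,C)·t)` with `det = 1` factorwise — converge to the weight-`0` truncation, an embedded
tensor `emb3 t'` with `t'` in the closure of the triple orbit and fixed by the one-parameter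
subgroup `(diag(exp(s E(·,k))))_k`; the hypothesis forces `E = 0`.

Theorem-only file (no definitions, no named facts). Honest framing: an elementary compactness
lemma of classical invariant theory; nothing here bears on VP versus VNP.

## References

* D. Mumford, J. Fogarty, F. Kirwan, *Geometric Invariant Theory*, 3rd ed. (1994), Ch. 2 §1
  (numerical criterion) and Ch. 4 §2 Prop. 4.2. [MumfordFogartyKirwan1994]
* P. Bürgisser, C. Ikenmeyer, *Fundamental invariants of orbit closures*, J. Algebra 477 (2017),
  §4.2 (polystable tensors), Prop. 4.10. [BurgisserIkenmeyer2017]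
* G. Kempf, L. Ness, *The length of vectors in representation spaces*, LNM 732 (1979), §1.
-/

noncomputable section

open Finset Filter
open scoped Matrix ComplexOrder Topology

namespace Literature.Computability.AlgebraicComplexity

section TripleNoFixedTorus

variable {τ : Type*} [Fintype τ] [DecidableEq τ]

omit [Fintype τ] [DecidableEq τ] in
/-- `emb3` is homogeneous: `emb3 (c • t) = c • emb3 t`. [folklore] -/
private theorem emb3_smul (c : ℂ) (t : τ → τ → τ → ℂ) : emb3 (c • t) = c • emb3 t := by
  funext j
  by_cases h : ∀ k, (j k).2 = k
  · rw [Pi.smul_apply, emb3_apply, emb3_apply, if_pos h, if_pos h]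
    rfl
  · rw [Pi.smul_apply, emb3_of_not_aligned _ h, emb3_of_not_aligned _ h, smul_zero]

omit [Fintype τ] [DecidableEq τ] in
/-- A tensor over `τ × Fin 3` supported on aligned words is the block embedding of its restriction.
[folklore] -/
private theorem emb3_restrict_eq {T : (Fin 3 → τ × Fin 3) → ℂ}
    (hT : ∀ j, (¬ ∀ k, (j k).2 = k) → T j = 0) :
    emb3 (fun a b c => T (word3 a b c)) = T := by
  funext j
  by_cases h : ∀ k, (j k).2 = k
  · rw [emb3_apply, if_pos h, word3_of_aligned h]
  · rw [emb3_of_not_aligned _ h, hT j h]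

/-- The triple action `(A ⊗ B ⊗ C)·t` of BI 2017 §4 is continuous in the three matrices (a
polynomial map). [cite: BurgisserIkenmeyer2017, §4 (the action of `GL_m^3` on `⊗³ℂ^m`)] -/
theorem continuous_tripleAct_left (t : τ → τ → τ → ℂ) :
    Continuous fun M : Fin 3 → Matrix τ τ ℂ => tripleAct (M 0) (M 1) (M 2) t := by
  have h : (fun M : Fin 3 → Matrix τ τ ℂ => tripleAct (M 0) (M 1) (M 2) t) =
      fun M => fun a b c => tensorAct (Matrix.blockDiagonal M) (emb3 t) (word3 a b c) := by
    funext M a b c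
    rw [tensorAct_blockDiagonal_emb3, emb3_word3]
  rw [h]
  refine continuous_pi fun a => continuous_pi fun b => continuous_pi fun c => ?_
  exact (continuous_apply _).comp
    ((continuous_tensorAct_left (emb3 t)).comp (continuous_id.matrix_blockDiagonal))

/-- Block-diagonal matrices with unitary blocks are unitary: `(V̂)ᴴ V̂ = 1`. [folklore] -/
private theorem conjTranspose_blockDiagonal_mul_self {V : Fin 3 → Matrix τ τ ℂ}
    (hV : ∀ k, (V k)ᴴ * V k = 1) :
    (Matrix.blockDiagonal V)ᴴ * Matrix.blockDiagonal V = 1 := by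
  rw [Matrix.blockDiagonal_conjTranspose, ← Matrix.blockDiagonal_mul]
  have : (fun k => (V k)ᴴ * V k) = (1 : Fin 3 → Matrix τ τ ℂ) := funext fun k => by
    rw [hV k]; rfl
  rw [this, Matrix.blockDiagonal_one]

omit [Fintype τ] in
/-- The block-diagonal matrix of three real diagonal scalings is the diagonal scaling of
`ℂ^{τ × Fin 3}` by the concatenated weight. [folklore] -/
private theorem blockDiagonal_diagonal_exp (E : τ × Fin 3 → ℝ) (s : ℝ) :
    Matrix.blockDiagonal (fun k : Fin 3 => Matrix.diagonal fun c : τ => (Real.exp (s * E (c, k)) : ℂ)) =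
      Matrix.diagonal fun p : τ × Fin 3 => (Real.exp (s * E p) : ℂ) := by
  rw [Matrix.blockDiagonal_diagonal]

/-- **An `SL³`-orbit of 3-tensors is closed as soon as no point of its closure is fixed by a
non-trivial real one-parameter torus.** If every `t'` in the classical closure of
`{(A,B,C)·t | det A = det B = det C = 1}` fixed by all
`(diag(exp(s e₀)), diag(exp(s e₁)), diag(exp(s e₂)))`, `s ∈ ℝ`, for some real `e : Fin 3 → τ → ℝ`
with `∑ e_k = 0` (`k = 0,1,2`), has `e = 0`, then the orbit is closed (compactness half of Mumford's
stability argument, GIT Prop. 4.2, for the `SL_m^3`-action of BI 2017 §4.2; OUR elementary proof by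
the `KAK` decomposition, not the printed Hilbert–Mumford route).
[cite: MumfordFogartyKirwan1994, Ch. 2 §1 Thm. 2.1 (weak form) and Ch. 4 §2 Prop. 4.2 (use)] -/
theorem isClosed_tripleOrbit_of_closure_noFixedTorus (t : τ → τ → τ → ℂ)
    (H : ∀ t' ∈ closure {s : τ → τ → τ → ℂ | ∃ A B C : Matrix τ τ ℂ,
        A.det = 1 ∧ B.det = 1 ∧ C.det = 1 ∧ tripleAct A B C t = s},
      ∀ e : Fin 3 → τ → ℝ, (∀ k, ∑ a, e k a = 0) →
        (∀ s : ℝ, tripleAct (Matrix.diagonal fun c => (Real.exp (s * e 0 c) : ℂ))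
            (Matrix.diagonal fun c => (Real.exp (s * e 1 c) : ℂ))
            (Matrix.diagonal fun c => (Real.exp (s * e 2 c) : ℂ)) t' = t') → e = 0) :
    IsClosed {s : τ → τ → τ → ℂ | ∃ A B C : Matrix τ τ ℂ,
        A.det = 1 ∧ B.det = 1 ∧ C.det = 1 ∧ tripleAct A B C t = s} := by
  haveI : FirstCountableTopology (Matrix τ τ ℂ) :=
    inferInstanceAs (FirstCountableTopology (τ → τ → ℂ))
  rw [← closure_subset_iff_isClosed]
  intro y hy
  obtain ⟨sq, hsq, hlim⟩ := mem_closure_iff_seq_limit.mp hy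
  choose A B C hA hB hC hABC using hsq
  -- the three factors as a `Fin 3`-family
  set M : ℕ → Fin 3 → Matrix τ τ ℂ := fun m => ![A m, B m, C m] with hMdef
  have hMdet : ∀ m k, (M m k).det = 1 := fun m k => by
    fin_cases k
    · exact hA m
    · exact hB m
    · exact hC m
  have hMact : ∀ m, tripleAct (M m 0) (M m 1) (M m 2) t = sq m := fun m => hABC m
  -- `KAK` decompositions, block by block
  choose V W θ hV hW hθ hkak using fun m k => exists_kak_of_det_eq_one (M m k) (hMdet m k)
  -- the big (block-diagonal) objects on `ℂ^{τ × Fin 3}`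
  set Θ : ℕ → τ × Fin 3 → ℝ := fun m p => θ m p.2 p.1 with hΘdef
  set bV : ℕ → Matrix (τ × Fin 3) (τ × Fin 3) ℂ := fun m => Matrix.blockDiagonal (V m) with hbVdef
  set bW : ℕ → Matrix (τ × Fin 3) (τ × Fin 3) ℂ := fun m => Matrix.blockDiagonal (W m) with hbWdef
  have hVV : ∀ m, (bV m)ᴴ * bV m = 1 := fun m =>
    conjTranspose_blockDiagonal_mul_self fun k => by
      have := Matrix.mem_unitaryGroup_iff'.mp (hV m k); rwa [Matrix.star_eq_conjTranspose] at this
  have hbig : ∀ m, Matrix.blockDiagonal (M m) =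
      bV m * Matrix.diagonal (fun p => (Real.exp (Θ m p) : ℂ)) * bW m := by
    intro m
    have h1 : M m = fun k => V m k * Matrix.diagonal (fun a => (Real.exp (θ m k a) : ℂ)) * W m k :=
      funext fun k => hkak m k
    rw [h1, Matrix.blockDiagonal_mul, Matrix.blockDiagonal_mul, Matrix.blockDiagonal_diagonal]
  -- the embedded sequence `S m = emb3 (sq m) = blockDiagonal (M m) • emb3 t`
  set S : ℕ → (Fin 3 → τ × Fin 3) → ℂ := fun m => emb3 (sq m) with hSdef
  have hSact : ∀ m, S m = tensorAct (Matrix.blockDiagonal (M m)) (emb3 t) := fun m => by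
    rw [hSdef]
    simp only
    rw [tensorAct_blockDiagonal_emb3, hMact m]
  have hSlim : Tendsto S atTop (𝓝 (emb3 y)) := (continuous_emb3.tendsto y).comp hlim
  -- the norms `‖S m‖²` are bounded ...
  obtain ⟨Cb, hCb⟩ : ∃ Cb, ∀ m, tnormSq (S m) ≤ Cb := by
    have h := (continuous_tnormSq.tendsto (emb3 y)).comp hSlim
    obtain ⟨Cb, hCb⟩ := h.bddAbove_range
    exact ⟨Cb, fun m => hCb ⟨m, rfl⟩⟩
  -- ... and given by the torus weights in the frame `bW m`
  have hnormS : ∀ m, tnormSq (S m) =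
      ∑ j : Fin 3 → τ × Fin 3, Real.exp (2 * ∑ k, Θ m (j k)) * ‖tensorAct (bW m) (emb3 t) j‖ ^ 2 := by
    intro m
    rw [hSact m, hbig m, tnormSq_tensorAct_kak (hVV m)]
  -- Case distinction: are the `Θ m` frequently bounded?
  by_cases hfreq : ∃ R : ℝ, ∃ᶠ m in atTop, ‖Θ m‖ ≤ R
  · /- Case A: a bounded subsequence; compactness gives a limit triple in `SL³` acting to `y`. -/
    obtain ⟨R, hR⟩ := hfreq
    obtain ⟨φ₁, hφ₁, hφ₁R⟩ := Filter.extraction_of_frequently_atTop hR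
    set U3 : Set (Fin 3 → Matrix τ τ ℂ) :=
      Set.univ.pi fun _ => (Matrix.unitaryGroup τ ℂ : Set (Matrix τ τ ℂ)) with hU3
    have hU3c : IsCompact U3 :=
      isCompact_univ_pi fun _ => Literature.NumberTheory.Automorphic.Matrix.isCompact_unitaryGroup
    set K : Set ((Fin 3 → Matrix τ τ ℂ) × ((τ × Fin 3 → ℝ) × (Fin 3 → Matrix τ τ ℂ))) :=
      U3 ×ˢ (Metric.closedBall (0 : τ × Fin 3 → ℝ) R ×ˢ U3) with hK
    have hKc : IsCompact K := hU3c.prod ((isCompact_closedBall _ _).prod hU3c)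
    set x : ℕ → (Fin 3 → Matrix τ τ ℂ) × ((τ × Fin 3 → ℝ) × (Fin 3 → Matrix τ τ ℂ)) :=
      fun m => (V (φ₁ m), (Θ (φ₁ m), W (φ₁ m))) with hx
    have hxK : ∀ m, x m ∈ K := fun m =>
      ⟨fun k _ => hV _ k, ⟨by simpa using hφ₁R m, fun k _ => hW _ k⟩⟩
    obtain ⟨pt, -, φ₂, hφ₂, hxlim⟩ := hKc.tendsto_subseq hxK
    -- the limit triple
    set F : (Fin 3 → Matrix τ τ ℂ) × ((τ × Fin 3 → ℝ) × (Fin 3 → Matrix τ τ ℂ)) →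
        Fin 3 → Matrix τ τ ℂ :=
      fun z k => z.1 k * Matrix.diagonal (fun c => (Real.exp (z.2.1 (c, k)) : ℂ)) * z.2.2 k with hF
    have hFcont : Continuous F := by
      refine continuous_pi fun k => ?_
      refine Continuous.matrix_mul (Continuous.matrix_mul ?_ ?_) ?_
      · exact (continuous_apply k).comp continuous_fst
      · refine Continuous.matrix_diagonal ?_
        refine continuous_pi fun c => ?_
        exact Complex.continuous_ofReal.comp (Real.continuous_exp.comp
          ((continuous_apply (c, k)).comp (continuous_fst.comp continuous_snd)))
      · exact (continuous_apply k).comp (continuous_snd.comp continuous_snd)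
    have hFx : ∀ m, F (x (φ₂ m)) = M (φ₁ (φ₂ m)) := fun m => by
      funext k
      rw [hF, hx]
      exact (hkak _ k).symm
    have hglim : Tendsto (fun m => M (φ₁ (φ₂ m))) atTop (𝓝 (F pt)) := by
      have := (hFcont.tendsto pt).comp hxlim
      refine this.congr fun m => ?_
      exact hFx m
    have hdetlim : ∀ k, (F pt k).det = 1 := by
      intro k
      have h1 : Tendsto (fun m => (M (φ₁ (φ₂ m)) k).det) atTop (𝓝 (F pt k).det) :=
        ((continuous_id.matrix_det).tendsto _).comp (((continuous_apply k).tendsto _).comp hglim)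
      have h2 : Tendsto (fun m => (M (φ₁ (φ₂ m)) k).det) atTop (𝓝 1) := by
        simp_rw [hMdet]; exact tendsto_const_nhds
      exact tendsto_nhds_unique h1 h2
    refine ⟨F pt 0, F pt 1, F pt 2, hdetlim 0, hdetlim 1, hdetlim 2, ?_⟩
    have h1 : Tendsto (fun m => tripleAct (M (φ₁ (φ₂ m)) 0) (M (φ₁ (φ₂ m)) 1) (M (φ₁ (φ₂ m)) 2) t)
        atTop (𝓝 (tripleAct (F pt 0) (F pt 1) (F pt 2) t)) :=
      ((continuous_tripleAct_left t).tendsto _).comp hglim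
    have h2 : Tendsto (fun m => tripleAct (M (φ₁ (φ₂ m)) 0) (M (φ₁ (φ₂ m)) 1) (M (φ₁ (φ₂ m)) 2) t)
        atTop (𝓝 y) := by
      simp_rw [hMact]
      exact hlim.comp (hφ₁.comp hφ₂).tendsto_atTop
    exact tendsto_nhds_unique h1 h2
  · /- Case B: `‖Θ m‖ → ∞`; a closure point fixed by a non-trivial real torus appears. -/
    exfalso
    have hdiv : Tendsto (fun m => ‖Θ m‖) atTop atTop := by
      rw [Filter.tendsto_atTop]
      intro R
      have : ∀ᶠ m in atTop, ¬ (‖Θ m‖ ≤ R) := Filter.not_frequently.mp (fun h => hfreq ⟨R, h⟩)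
      filter_upwards [this] with m hm
      exact (not_le.mp hm).le
    -- normalised weights
    set rr : ℕ → ℝ := fun m => ‖Θ m‖ with hrr
    set ε : ℕ → τ × Fin 3 → ℝ := fun m => (rr m)⁻¹ • Θ m with hε
    have hpos_ev : ∀ᶠ m in atTop, 0 < rr m := hdiv.eventually_gt_atTop 0
    obtain ⟨φ₁, hφ₁, hφ₁pos⟩ := Filter.extraction_of_frequently_atTop hpos_ev.frequently
    have hεnorm : ∀ m, ‖ε (φ₁ m)‖ = 1 := fun m => by
      rw [hε]
      simp only
      rw [norm_smul, norm_inv, norm_norm, inv_mul_cancel₀ (hφ₁pos m).ne']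
    have hΘsum : ∀ m k, ∑ a, Θ m (a, k) = 0 := fun m k => hθ m k
    have hεsum : ∀ m k, ∑ a, ε (φ₁ m) (a, k) = 0 := fun m k => by
      rw [hε]
      simp only [Pi.smul_apply, smul_eq_mul, ← Finset.mul_sum, hΘsum, mul_zero]
    have hθε : ∀ m p, Θ (φ₁ m) p = rr (φ₁ m) * ε (φ₁ m) p := fun m p => by
      rw [hε]
      simp only [Pi.smul_apply, smul_eq_mul]
      rw [← mul_assoc, mul_inv_cancel₀ (hφ₁pos m).ne', one_mul]
    -- compactness: `ε → E`, `W → W∞` along a further subsequence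
    set U3 : Set (Fin 3 → Matrix τ τ ℂ) :=
      Set.univ.pi fun _ => (Matrix.unitaryGroup τ ℂ : Set (Matrix τ τ ℂ)) with hU3
    have hU3c : IsCompact U3 :=
      isCompact_univ_pi fun _ => Literature.NumberTheory.Automorphic.Matrix.isCompact_unitaryGroup
    set K : Set ((τ × Fin 3 → ℝ) × (Fin 3 → Matrix τ τ ℂ)) :=
      Metric.sphere (0 : τ × Fin 3 → ℝ) 1 ×ˢ U3 with hK
    have hKc : IsCompact K := (isCompact_sphere _ _).prod hU3c
    set x : ℕ → (τ × Fin 3 → ℝ) × (Fin 3 → Matrix τ τ ℂ) := fun m => (ε (φ₁ m), W (φ₁ m)) with hx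
    have hxK : ∀ m, x m ∈ K := fun m =>
      ⟨mem_sphere_zero_iff_norm.mpr (hεnorm m), fun k _ => hW _ k⟩
    obtain ⟨⟨E, Winf3⟩, ⟨hE1, hWinf3⟩, φ₂, hφ₂, hxlim⟩ := hKc.tendsto_subseq hxK
    set ψ : ℕ → ℕ := fun m => φ₁ (φ₂ m) with hψ
    have hεlim : Tendsto (fun m => ε (ψ m)) atTop (𝓝 E) := (continuous_fst.tendsto _).comp hxlim
    have hW3lim : Tendsto (fun m => W (ψ m)) atTop (𝓝 Winf3) := (continuous_snd.tendsto _).comp hxlim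
    set Winf : Matrix (τ × Fin 3) (τ × Fin 3) ℂ := Matrix.blockDiagonal Winf3 with hWinfdef
    have hWlim : Tendsto (fun m => bW (ψ m)) atTop (𝓝 Winf) :=
      (continuous_id.matrix_blockDiagonal.tendsto _).comp hW3lim
    have hεlim' : ∀ p, Tendsto (fun m => ε (ψ m) p) atTop (𝓝 (E p)) := fun p =>
      ((continuous_apply p).tendsto _).comp hεlim
    have hrlim : Tendsto (fun m => rr (ψ m)) atTop atTop := hdiv.comp (hφ₁.comp hφ₂).tendsto_atTop
    have hWinf3u : ∀ k, Winf3 k ∈ Matrix.unitaryGroup τ ℂ := fun k => hWinf3 k (Set.mem_univ k)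
    -- properties of the limit weight `E`
    have hEsum : ∀ k, ∑ a, E (a, k) = 0 := by
      intro k
      have h1 : Tendsto (fun m => ∑ a, ε (ψ m) (a, k)) atTop (𝓝 (∑ a, E (a, k))) :=
        tendsto_finsetSum _ fun a _ => hεlim' (a, k)
      have h2 : Tendsto (fun m => ∑ a, ε (ψ m) (a, k)) atTop (𝓝 0) := by
        simp_rw [hψ, hεsum]; exact tendsto_const_nhds
      exact tendsto_nhds_unique h1 h2
    have hEsum' : ∑ p : τ × Fin 3, E p = 0 := by
      rw [Fintype.sum_prod_type_right]
      exact Finset.sum_eq_zero fun k _ => hEsum k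
    have hE_ne : E ≠ 0 := by
      intro h0
      rw [mem_sphere_zero_iff_norm, h0, norm_zero] at hE1
      exact zero_ne_one hE1
    -- (1) the coordinates of positive limit weight vanish in the limit frame `Winf`
    have hvanish : ∀ j : Fin 3 → τ × Fin 3, 0 < ∑ k, E (j k) → tensorAct Winf (emb3 t) j = 0 := by
      intro j hj
      have hterm : ∀ m, Real.exp (2 * ∑ k, Θ m (j k)) * ‖tensorAct (bW m) (emb3 t) j‖ ^ 2 ≤ Cb := by
        intro m
        refine le_trans ?_ (hCb m)
        rw [hnormS m]
        exact Finset.single_le_sum (f := fun i => Real.exp (2 * ∑ k, Θ m (i k)) *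
          ‖tensorAct (bW m) (emb3 t) i‖ ^ 2) (fun i _ => by positivity) (Finset.mem_univ j)
      have hw : Tendsto (fun m => ∑ k, ε (ψ m) (j k)) atTop (𝓝 (∑ k, E (j k))) :=
        tendsto_finsetSum _ fun k _ => hεlim' (j k)
      have hwpos : ∀ᶠ m in atTop, (∑ k, E (j k)) / 2 ≤ ∑ k, ε (ψ m) (j k) :=
        (hw.eventually (eventually_ge_nhds (by linarith))).mono fun m hm => hm
      have hrpos : ∀ᶠ m in atTop, 0 ≤ rr (ψ m) := hrlim.eventually_ge_atTop 0
      have hlin : Tendsto (fun m => rr (ψ m) * ((∑ k, E (j k)) / 2)) atTop atTop :=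
        hrlim.atTop_mul_const (by linarith)
      have hwt : Tendsto (fun m => 2 * ∑ k, Θ (ψ m) (j k)) atTop atTop := by
        refine tendsto_atTop_mono' atTop ?_ (Tendsto.const_mul_atTop (by norm_num : (0 : ℝ) < 2) hlin)
        filter_upwards [hwpos, hrpos] with m hm hr
        have hθm : ∑ k, Θ (ψ m) (j k) = rr (ψ m) * ∑ k, ε (ψ m) (j k) := by
          rw [Finset.mul_sum]
          exact Finset.sum_congr rfl fun k _ => hθε (φ₂ m) (j k)
        rw [hθm]
        have := mul_le_mul_of_nonneg_left hm hr
        linarith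
      have hexp : Tendsto (fun m => Real.exp (2 * ∑ k, Θ (ψ m) (j k))) atTop atTop :=
        Real.tendsto_exp_atTop.comp hwt
      have hup : Tendsto (fun m => Cb * (Real.exp (2 * ∑ k, Θ (ψ m) (j k)))⁻¹) atTop (𝓝 0) := by
        have := hexp.inv_tendsto_atTop.const_mul Cb
        rwa [mul_zero] at this
      have hsq0 : Tendsto (fun m => ‖tensorAct (bW (ψ m)) (emb3 t) j‖ ^ 2) atTop (𝓝 0) := by
        refine squeeze_zero (fun m => by positivity) (fun m => ?_) hup
        rw [← div_eq_mul_inv, le_div_iff₀ (Real.exp_pos _), mul_comm]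
        exact hterm (ψ m)
      have hsq : Tendsto (fun m => ‖tensorAct (bW (ψ m)) (emb3 t) j‖ ^ 2) atTop
          (𝓝 (‖tensorAct Winf (emb3 t) j‖ ^ 2)) := by
        have : Tendsto (fun m => tensorAct (bW (ψ m)) (emb3 t) j) atTop
            (𝓝 (tensorAct Winf (emb3 t) j)) :=
          ((continuous_apply j).tendsto _).comp
            (((continuous_tensorAct_left (emb3 t)).tendsto _).comp hWlim)
        exact (this.norm).pow 2
      have h0 : ‖tensorAct Winf (emb3 t) j‖ ^ 2 = 0 := tendsto_nhds_unique hsq hsq0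
      exact norm_eq_zero.mp (pow_eq_zero_iff two_ne_zero |>.mp h0)
    -- (2) rescale the three limit unitaries into `SL`
    haveI : Nonempty τ := by
      by_contra hne
      rw [not_nonempty_iff] at hne
      exact hE_ne (funext fun p => (IsEmpty.false p.1).elim)
    have hdetW : ∀ k, (Winf3 k).det ≠ 0 := by
      intro k h0
      have := congrArg Matrix.det (Matrix.mem_unitaryGroup_iff.mp (hWinf3u k))
      rw [Matrix.det_mul, h0, zero_mul, Matrix.det_one] at this
      exact zero_ne_one this
    choose c hc using fun k => IsAlgClosed.exists_pow_nat_eq (Winf3 k).det (Fintype.card_pos (α := τ))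
    have hc0 : ∀ k, c k ≠ 0 := by
      intro k h0
      have := hc k
      rw [h0, zero_pow (Fintype.card_pos (α := τ)).ne'] at this
      exact hdetW k this.symm
    set W' : Fin 3 → Matrix τ τ ℂ := fun k => (c k)⁻¹ • Winf3 k with hW'
    have hW'det : ∀ k, (W' k).det = 1 := fun k => by
      rw [hW', Matrix.det_smul, ← hc k, inv_pow, inv_mul_cancel₀ (pow_ne_zero _ (hc0 k))]
    set u : τ → τ → τ → ℂ := tripleAct (W' 0) (W' 1) (W' 2) t with hu
    set T : (Fin 3 → τ × Fin 3) → ℂ := tensorAct (Matrix.blockDiagonal W') (emb3 t) with hT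
    have hTu : T = emb3 u := by rw [hT, hu, tensorAct_blockDiagonal_emb3]
    have hWinf_act : tensorAct Winf (emb3 t) = (c 0 * c 1 * c 2) • T := by
      have hW3 : Winf3 = fun k => c k • W' k := funext fun k => by
        rw [hW', smul_smul, mul_inv_cancel₀ (hc0 k), one_smul]
      rw [hWinfdef, hW3, tensorAct_blockDiagonal_emb3, hTu, ← emb3_smul]
      congr 1
      exact tripleAct_smul (c 0) (c 1) (c 2) (W' 0) (W' 1) (W' 2) t
    have hTvanish : ∀ j : Fin 3 → τ × Fin 3, 0 < ∑ k, E (j k) → T j = 0 := by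
      intro j hj
      have h := hvanish j hj
      rw [hWinf_act, Pi.smul_apply, smul_eq_mul] at h
      exact (mul_eq_zero.mp h).resolve_left (mul_ne_zero (mul_ne_zero (hc0 0) (hc0 1)) (hc0 2))
    have hTaligned : ∀ j, (¬ ∀ k, (j k).2 = k) → T j = 0 := fun j hj => by
      rw [hTu, emb3_of_not_aligned _ hj]
    -- (3) the one-parameter limit `diag(exp(s E)) • T → T'`, the truncation to weight `0`
    set T' : (Fin 3 → τ × Fin 3) → ℂ := fun j => if ∑ k, E (j k) = 0 then T j else 0 with hT'
    have hconv : Tendsto (fun s : ℝ => tensorAct (Matrix.diagonal fun p => (Real.exp (s * E p) : ℂ)) T)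
        atTop (𝓝 T') := by
      rw [tendsto_pi_nhds]
      intro j
      simp_rw [tensorAct_diagonal_exp_apply]
      rcases lt_trichotomy (∑ k, E (j k)) 0 with hneg | hzero | hpos
      · have hT'j : T' j = 0 := by rw [hT']; exact if_neg hneg.ne
        rw [hT'j]
        have h1 : Tendsto (fun s : ℝ => s * ∑ k, E (j k)) atTop atBot :=
          tendsto_id.atTop_mul_const_of_neg hneg
        have h2 : Tendsto (fun s : ℝ => Real.exp (s * ∑ k, E (j k))) atTop (𝓝 0) :=
          Real.tendsto_exp_atBot.comp h1
        have h3 : Tendsto (fun s : ℝ => (Real.exp (s * ∑ k, E (j k)) : ℂ)) atTop (𝓝 0) := by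
          have := (Complex.continuous_ofReal.tendsto 0).comp h2
          rwa [Complex.ofReal_zero] at this
        have := h3.mul_const (T j)
        rwa [zero_mul] at this
      · have hT'j : T' j = T j := by rw [hT']; exact if_pos hzero
        rw [hT'j]
        simp_rw [hzero, mul_zero, Real.exp_zero, Complex.ofReal_one, one_mul]
        exact tendsto_const_nhds
      · have hT'j : T' j = 0 := by rw [hT']; exact if_neg hpos.ne'
        rw [hT'j, hTvanish j hpos]
        simp_rw [mul_zero]
        exact tendsto_const_nhds
    have hT'aligned : ∀ j, (¬ ∀ k, (j k).2 = k) → T' j = 0 := fun j hj => by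
      rw [hT']
      simp only
      rw [hTaligned j hj, ite_self]
    -- `T' = emb3 t'` with `t'` in the closure of the triple orbit
    set t' : τ → τ → τ → ℂ := fun a b c => T' (word3 a b c) with ht'
    have hT't' : emb3 t' = T' := emb3_restrict_eq hT'aligned
    -- the approximating triple-orbit family
    set D : ℝ → Fin 3 → Matrix τ τ ℂ := fun s k =>
      Matrix.diagonal fun c : τ => (Real.exp (s * E (c, k)) : ℂ) with hD
    have hDdet : ∀ s k, (D s k).det = 1 := fun s k =>
      det_diagonal_exp_eq_one (θ := fun c => E (c, k)) (hEsum k) s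
    have hDbig : ∀ s, Matrix.blockDiagonal (D s) =
        Matrix.diagonal fun p : τ × Fin 3 => (Real.exp (s * E p) : ℂ) := fun s =>
      blockDiagonal_diagonal_exp E s
    set fam : ℝ → τ → τ → τ → ℂ := fun s =>
      tripleAct (D s 0 * W' 0) (D s 1 * W' 1) (D s 2 * W' 2) t with hfam
    have hfam_emb : ∀ s, emb3 (fam s) =
        tensorAct (Matrix.diagonal fun p => (Real.exp (s * E p) : ℂ)) T := by
      intro s
      have key : tensorAct (Matrix.blockDiagonal fun k => D s k * W' k) (emb3 t) = emb3 (fam s) := by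
        rw [tensorAct_blockDiagonal_emb3]
      rw [← key, Matrix.blockDiagonal_mul, tensorAct_mul, hDbig s, hT]
    have hfam_mem : ∀ s, fam s ∈ {s : τ → τ → τ → ℂ | ∃ A B C : Matrix τ τ ℂ,
        A.det = 1 ∧ B.det = 1 ∧ C.det = 1 ∧ tripleAct A B C t = s} := fun s =>
      ⟨D s 0 * W' 0, D s 1 * W' 1, D s 2 * W' 2,
        by rw [Matrix.det_mul, hDdet, hW'det, one_mul],
        by rw [Matrix.det_mul, hDdet, hW'det, one_mul],
        by rw [Matrix.det_mul, hDdet, hW'det, one_mul], rfl⟩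
    have hfam_lim : Tendsto fam atTop (𝓝 t') := by
      rw [tendsto_pi_nhds]; intro a
      rw [tendsto_pi_nhds]; intro b
      rw [tendsto_pi_nhds]; intro c'
      have h1 : ∀ s, fam s a b c' = emb3 (fam s) (word3 a b c') := fun s => by rw [emb3_word3]
      simp_rw [h1, hfam_emb]
      exact ((continuous_apply (word3 a b c')).tendsto _).comp hconv
    have ht'mem : t' ∈ closure {s : τ → τ → τ → ℂ | ∃ A B C : Matrix τ τ ℂ,
        A.det = 1 ∧ B.det = 1 ∧ C.det = 1 ∧ tripleAct A B C t = s} :=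
      mem_closure_of_tendsto hfam_lim (Filter.Eventually.of_forall hfam_mem)
    -- `t'` is fixed by the one-parameter subgroup
    have hT'fix : ∀ s : ℝ, tensorAct (Matrix.diagonal fun p => (Real.exp (s * E p) : ℂ)) T' = T' :=
      fun s => tensorAct_diagonal_exp_eq_self (fun j hj => by
        by_contra h
        apply hj
        rw [hT']
        exact if_neg h) s
    have ht'fix : ∀ s : ℝ, tripleAct (D s 0) (D s 1) (D s 2) t' = t' := by
      intro s
      apply emb3_injective
      rw [← tensorAct_blockDiagonal_emb3, hDbig s, hT't', hT'fix s]
    -- the hypothesis forces `E = 0`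
    have hE0 := H t' ht'mem (fun k c => E (c, k)) (fun k => hEsum k) (fun s => ht'fix s)
    apply hE_ne
    funext p
    have := congr_fun (congr_fun hE0 p.2) p.1
    exact this

/-- **The same in the spelling of `IsPolystableTensor`**: a tensor `w ∈ ⊗³ℂ^ι` whose
`SL_ι(ℂ)³`-orbit closure contains no point fixed by a non-trivial real diagonal one-parameter
subgroup of `SL³` is polystable (its orbit `Set.range (g ↦ actTensor g₁ g₂ g₃ w)` is closed;
`range_sl3_actTensor_eq`, `actTensor_eq_tripleAct`).
[cite: BurgisserIkenmeyer2017, §4.2 (polystable tensors), via MumfordFogartyKirwan1994 Ch. 4 §2 Prop. 4.2] -/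
theorem isPolystableTensor_of_closure_noFixedTorus {ι : Type*} [Fintype ι] [DecidableEq ι]
    (w : ι → ι → ι → ℂ)
    (H : ∀ t' ∈ closure (Set.range fun g : Matrix.SpecialLinearGroup ι ℂ ×
          Matrix.SpecialLinearGroup ι ℂ × Matrix.SpecialLinearGroup ι ℂ =>
        actTensor (g.1 : Matrix ι ι ℂ) (g.2.1 : Matrix ι ι ℂ) (g.2.2 : Matrix ι ι ℂ) w),
      ∀ e : Fin 3 → ι → ℝ, (∀ k, ∑ a, e k a = 0) →
        (∀ s : ℝ, actTensor (Matrix.diagonal fun c => (Real.exp (s * e 0 c) : ℂ))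
            (Matrix.diagonal fun c => (Real.exp (s * e 1 c) : ℂ))
            (Matrix.diagonal fun c => (Real.exp (s * e 2 c) : ℂ)) t' = t') → e = 0) :
    IsPolystableTensor w := by
  unfold IsPolystableTensor
  rw [range_sl3_actTensor_eq] at H ⊢
  exact isClosed_tripleOrbit_of_closure_noFixedTorus w H

end TripleNoFixedTorus

end Literature.Computability.AlgebraicComplexity

end
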